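import Summits.CriticalPhenomena.SAWScalingLimit.Theorems.SAWLoopFugacityFlowSimpleSubseqLimitsLatticeBound
import Summits.CriticalPhenomena.SAWScalingLimit.Theorems.SAWLoopFugacityFlowSimpleSubseqLimitsSubArc
import Literature.Probability.RandomPlanarGeometry.CurveSpace
import HarnessLib

/-!
# Line `slit-continuous-restriction` — the soft transfer, part 1: the open input, its locally
# uniform form, and far-past stability (crux stmt-CriticalPhenomena-4982, decl
# `Summit.CriticalPhenomena.SAWScalingLimit.Theses.SAWLoopFugacityFlow.SimpleSubseqLimits`;
# registered skeleton `Cruxes/SimpleSubseqLimits/Lines/slit_continuous_restriction.lean`)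

This is the first of the files proving the registered stub `stub_transferCore` of the line
(lead c9). It re-declares VERBATIM the skeleton's vocabulary `farPast` and the OPEN input
`SequentialSlitAvoidance` (over the landed `Arc.IsAdmissiblePast`, `Lattice.prefixEvent`,
`Lattice.approachEvent`), and proves:

* `locallyUniform_of_sequential` — the SEQUENTIAL conditional bound (along every sequence of
  first-entrance prefixes converging to an admissible limit past `π`) is LOCALLY UNIFORM: there are
  an open neighbourhood `N ∋ mk π` and a mesh threshold `δ₀` such that the bound holds for every
  first-entrance prefix of mesh `< δ₀` whose class lies in `N` (by contradiction, with the balls of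
  radius `1/(n+1)` about `mk π` and meshes `< 1/(n+1)`);
* `farPast_anti`, `farPast_subset_thickening` — the far past shrinks as the guard radius grows, and
  a curve uniformly `ζ`-close to a reparametrisation of another has its `R`-far past inside the
  `ζ`-thickening of the other's `(R - ζ)`-far past (the stability used to charge a lattice prefix
  to a nearby cover element).
-/

noncomputable section

open MeasureTheory Filter Topology Set Metric Function
open Literature.Probability.RandomPlanarGeometry Literature.Probability.RandomPlanarGeometry.SAW
open Literature.Probability.LatticeModels
open scoped ENNReal NNReal unitInterval

namespace Summit.CriticalPhenomena.SAWScalingLimit.Theorems.SimpleSubseqLimits.SlitRestriction.Transfer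

open Summit.CriticalPhenomena.SAWScalingLimit.Theorems.SimpleSubseqLimits.SlitRestriction.Lattice
  (prefixEvent approachEvent)
open Summit.CriticalPhenomena.SAWScalingLimit.Theorems.SimpleSubseqLimits.SlitRestriction.Arc
  (IsAdmissiblePast)

/-! ## Vocabulary (verbatim the registered skeleton) -/

/-- **Far past** of a (limit) past curve `π` with respect to the centre `q` and the guard radius `R`: the
values taken while the curve had always been `R`-far from `q` (the set the route's `PastFutureAvoidance` /
`FarReturn` guard against). [folklore] -/
def farPast (π : Curve ℂ) (q : ℂ) (R : ℝ) : Set ℂ :=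
  (fun u : I => π u) '' {u : I | ∀ u' : I, u' ≤ u → R < dist (π u') q}

/-- **SEQUENTIAL SLIT AVOIDANCE** — the line's OPEN input (the conditional, sequence-continuous form of the
A-side; deliberately untagged: not a literature fact). For every Dobrushin domain and endpoint approximation,
every admissible limit past `π` at the entrance ball `B̄(q, ρ)`, guard radius `R > ρ` and target `θ > 0`
there is a width `ε > 0` such that along EVERY sequence of meshes `s n → 0⁺` and lattice first-entrance
prefixes `ω n : a_{s n} → t n` (tip in `B̄(q, ρ)`, earlier vertices outside) whose curve classes converge
to the class of `π`, eventually the critical SAW law of the prefix event intersected with "a later vertex is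
`ε`-close to `far_R(π)`" is at most `θ` times the law of the prefix event (conditional far-slit avoidance
given the prefix, in cross-multiplied form; junk-safe: both sides vanish when no walk has the prefix).
Registered stub statement of crux stmt-CriticalPhenomena-4982 (line slit-continuous-restriction): the OPEN
input, consumed here as a hypothesis only. -/
def SequentialSlitAvoidance : Prop :=
  ∀ (D : DobrushinDomain) (a b : ℝ → Site 2), SAW.IsEndpointApprox D a b →
    ∀ (π : Curve ℂ) (q : ℂ) (ρ R : ℝ), 0 < ρ → ρ < R → IsAdmissiblePast D π q ρ →
      ∀ θ : ℝ, 0 < θ → ∃ ε : ℝ, 0 < ε ∧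
        ∀ (s : ℕ → ℝ) (t : ℕ → Site 2) (ω : ∀ n : ℕ, SAW.DomainSAW D.carrier (s n) (a (s n)) (t n)),
          Tendsto s atTop (𝓝[>] (0 : ℝ)) →
          (∀ n : ℕ, meshPoint (s n) (t n) ∈ closedBall q ρ) →
          (∀ n : ℕ, ∀ x ∈ (ω n).walk.support.dropLast, meshPoint (s n) x ∉ closedBall q ρ) →
          Tendsto (fun n => (ω n).curve) atTop (𝓝 (CurveClass.mk π)) →
          ∀ᶠ n in atTop,
            SAW.law D.carrier (s n) (a (s n)) (b (s n))
                (approachEvent (v := b (s n)) (ω n) (farPast π q R) ε) ≤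
              ENNReal.ofReal θ *
                SAW.law D.carrier (s n) (a (s n)) (b (s n)) (prefixEvent (v := b (s n)) (ω n))

/-- **LOCALLY UNIFORM SLIT AVOIDANCE** (the form the transfer consumes): for every admissible limit
past `π` and target `θ > 0` there are a width `ε > 0`, an OPEN neighbourhood `N` of `mk π` and a mesh
threshold `δ₀ > 0` such that for every mesh `δ ∈ (0, δ₀)` and every lattice first-entrance prefix `ω`
into `B̄(q, ρ)` (tip inside, earlier vertices outside) whose class lies in `N`, the conditional bound
`P[approachEvent ω (far_R π) ε] ≤ θ · P[prefixEvent ω]` holds. (Auxiliary statement of the transfer,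
line slit-continuous-restriction of crux stmt-CriticalPhenomena-4982; derived below from the open input,
not a literature fact.) -/
def LocallyUniformSlitAvoidance : Prop :=
  ∀ (D : DobrushinDomain) (a b : ℝ → Site 2), SAW.IsEndpointApprox D a b →
    ∀ (π : Curve ℂ) (q : ℂ) (ρ R : ℝ), 0 < ρ → ρ < R → IsAdmissiblePast D π q ρ →
      ∀ θ : ℝ, 0 < θ → ∃ ε : ℝ, 0 < ε ∧ ∃ N : Set (CurveClass ℂ), IsOpen N ∧
        CurveClass.mk π ∈ N ∧ ∃ δ₀ : ℝ, 0 < δ₀ ∧ ∀ δ : ℝ, 0 < δ → δ < δ₀ →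
          ∀ (t : Site 2) (ω : SAW.DomainSAW D.carrier δ (a δ) t),
            meshPoint δ t ∈ closedBall q ρ →
            (∀ x ∈ ω.walk.support.dropLast, meshPoint δ x ∉ closedBall q ρ) →
            ω.curve ∈ N →
            SAW.law D.carrier δ (a δ) (b δ) (approachEvent (v := b δ) ω (farPast π q R) ε) ≤
              ENNReal.ofReal θ * SAW.law D.carrier δ (a δ) (b δ) (prefixEvent (v := b δ) ω)

/-! ## Sequential ⇒ locally uniform -/

/-- A sequence squeezed in `(0, 1/(n+1))` tends to `0` from the right. [folklore] -/
theorem tendsto_nhdsGT_of_squeeze {s : ℕ → ℝ} (h0 : ∀ n, 0 < s n)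
    (h1 : ∀ n, s n < 1 / ((n : ℝ) + 1)) : Tendsto s atTop (𝓝[>] (0 : ℝ)) := by
  refine tendsto_nhdsWithin_iff.2 ⟨?_, Eventually.of_forall fun n => h0 n⟩
  exact squeeze_zero (fun n => (h0 n).le) (fun n => (h1 n).le) tendsto_one_div_add_atTop_nhds_zero_nat

/-- **Sequential slit avoidance is locally uniform.** If the bound failed in every neighbourhood of
`mk π` below every mesh threshold, choosing violating first-entrance prefixes in the balls of radius
`1/(n+1)` at meshes `< 1/(n+1)` would produce a sequence along which the sequential statement is
contradicted at every index. [folklore] -/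
theorem locallyUniform_of_sequential : SequentialSlitAvoidance → LocallyUniformSlitAvoidance := by
  intro h D a b hab π q ρ R hρ hρR hadm θ hθ
  obtain ⟨ε, hε, hseq⟩ := h D a b hab π q ρ R hρ hρR hadm θ hθ
  refine ⟨ε, hε, ?_⟩
  by_contra hcon
  push Not at hcon
  have hex : ∀ n : ℕ, ∃ δ : ℝ, 0 < δ ∧ δ < 1 / ((n : ℝ) + 1) ∧
      ∃ (t : Site 2) (ω : SAW.DomainSAW D.carrier δ (a δ) t),
        meshPoint δ t ∈ closedBall q ρ ∧
        (∀ x ∈ ω.walk.support.dropLast, meshPoint δ x ∉ closedBall q ρ) ∧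
        ω.curve ∈ ball (CurveClass.mk π) (1 / ((n : ℝ) + 1)) ∧
        ENNReal.ofReal θ * SAW.law D.carrier δ (a δ) (b δ) (prefixEvent (v := b δ) ω) <
            SAW.law D.carrier δ (a δ) (b δ) (approachEvent (v := b δ) ω (farPast π q R) ε) := by
    intro n
    obtain ⟨δ, hδ0, hδ1, t, ω, htip, hout, hN, hviol⟩ :=
      hcon (ball (CurveClass.mk π) (1 / ((n : ℝ) + 1))) isOpen_ball
        (mem_ball_self Nat.one_div_pos_of_nat) (1 / ((n : ℝ) + 1)) Nat.one_div_pos_of_nat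
    exact ⟨δ, hδ0, hδ1, t, ω, htip, hout, hN, hviol⟩
  choose s hs0 hs1 t ω htip hout hN hviol using hex
  have hsT : Tendsto s atTop (𝓝[>] (0 : ℝ)) := tendsto_nhdsGT_of_squeeze hs0 hs1
  have hcv : Tendsto (fun n => (ω n).curve) atTop (𝓝 (CurveClass.mk π)) := by
    rw [tendsto_iff_dist_tendsto_zero]
    refine squeeze_zero (fun n => dist_nonneg) (fun n => ?_) tendsto_one_div_add_atTop_nhds_zero_nat
    exact (mem_ball.1 (hN n)).le
  obtain ⟨n, hn⟩ := (hseq s t ω hsT htip hout hcv).exists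
  exact absurd hn (not_le.2 (hviol n))

/-! ## Far-past monotonicity and stability -/

/-- The far past shrinks as the guard radius grows. [folklore] -/
theorem farPast_anti (π : Curve ℂ) (q : ℂ) {R₁ R₂ : ℝ} (h : R₁ ≤ R₂) :
    farPast π q R₂ ⊆ farPast π q R₁ := by
  rintro _ ⟨u, hu, rfl⟩
  exact ⟨u, fun u' hu' => h.trans_lt (hu u' hu'), rfl⟩

/-- **Far-past stability.** If `π` is uniformly `ζ`-close to the reparametrisation `π' ∘ φ` of
another curve, then the `R`-far past of `π` lies in the (open) `ζ`-thickening of the `(R - ζ)`-far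
past of `π'`: the matched point `π' (φ u)` is `ζ`-close, and every earlier value of `π'` is matched
with an earlier value of `π`, at distance `> R - ζ` from `q`. [folklore] -/
theorem farPast_subset_thickening {π π' : Curve ℂ} {φ : I ≃o I} {ζ : ℝ}
    (h : ∀ u : I, dist (π u) (π' (φ u)) < ζ) (q : ℂ) (R : ℝ) :
    farPast π q R ⊆ thickening ζ (farPast π' q (R - ζ)) := by
  rintro _ ⟨u, hu, rfl⟩
  rw [mem_thickening_iff]
  refine ⟨π' (φ u), ⟨φ u, fun w' hw' => ?_, rfl⟩, h u⟩
  have hle : φ.symm w' ≤ u := φ.symm_apply_le.2 hw'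
  have h₁ := hu (φ.symm w') hle
  have h₂ := h (φ.symm w')
  rw [OrderIso.apply_symm_apply] at h₂
  have h₃ := dist_triangle (π (φ.symm w')) (π' w') q
  linarith

/-- Far-past stability for CLASSES: if the class of `π` is within `ζ` of the class of `π'`, the `R`-far
past of `π` lies in the `ζ`-thickening of the `R'`-far past of `π'` whenever `R' ≤ R - ζ`
(`Curve.exists_dist_reparam_lt` realises the distance by a reparametrisation). [folklore] -/
theorem farPast_subset_thickening_of_dist_lt {π π' : Curve ℂ} {ζ : ℝ}
    (h : dist (CurveClass.mk π) (CurveClass.mk π') < ζ) (q : ℂ) {R R' : ℝ} (hR : R' ≤ R - ζ) :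
    farPast π q R ⊆ thickening ζ (farPast π' q R') := by
  rw [CurveClass.dist_mk_mk] at h
  obtain ⟨φ, hφ⟩ := Curve.exists_dist_reparam_lt h
  have hcl : ∀ u : I, dist (π u) (π' (φ u)) < ζ := fun u => by
    have h' := ContinuousMap.dist_apply_le_dist (f := π.toContinuousMap)
      (g := (π'.reparam φ).toContinuousMap) (x := u)
    simp only [Curve.coe_toContinuousMap, Curve.reparam_apply] at h'
    exact h'.trans_lt hφ
  exact (farPast_subset_thickening hcl q R).trans (thickening_subset_of_subset _ (farPast_anti π' q hR))

end Summit.CriticalPhenomena.SAWScalingLimit.Theorems.SimpleSubseqLimits.SlitRestriction.Transfer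

end
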